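import Literature.Geometry.Kaehler.ComplexTorusAnalyticLimitSet
import Literature.Geometry.Kaehler.HolomorphicChainLimitMultiplicity
import Literature.Geometry.Kaehler.HolomorphicChainSupportComponents
import HarnessLib

/-!
# The limit chain of a convergent sequence of analytic subsets of a complex torus

Layer `Literature/Geometry/Kaehler`; lane `lit-hodgefound`, seat p07, programme «BOUNDED CYCLES ON A
COMPLEX TORUS», file 5. Let `X = E/Λ` be a complex torus, `Z_j ⊆ X` analytic subsets of pure dimension
`p = d + 1` whose lifted currents converge, `[π⁻¹ Z_j] → [T]`, to a positive holomorphic `p`-chain `T`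
on `E` (`ComplexTorusAnalyticCycleClassBoundedVolume.lean`; [Chirka1989, §16.1 Prop. 1]). By
`ComplexTorusAnalyticLimitSet.lean` the support `|T|` is `Λ`-periodic and descends to a closed
analytic `W = π(|T|) ⊆ X`. Here the MULTIPLICITIES descend as well:

* `ComplexTorus.finsum_lelongNumber_limit_latticeVec_add` — **the Lelong number `n([T], ·)` of the
  limit chain is `Λ`-invariant**: by [Chirka1989, §16.1 Prop. 1 (proof), p. 207]
  (`tendsto_liminf_variation_ball_div_of_tendsto`) `n([T], a) = lim_r liminf_j ‖[π⁻¹Z_j]‖(B(a,r))/c r^{2p}`,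
  and the masses `‖[π⁻¹Z_j]‖(B(a,r)) = 𝓗^{2p}(π⁻¹Z_j ∩ B(a,r))` are `Λ`-invariant in `a`;
* `ComplexTorus.latticeVec_add_mem_carrier_limit_iff`, `ComplexTorus.density_limit_latticeVec_add` —
  **the carrier `reg|T|` and the density `θ_T` of the limit chain are `Λ`-periodic** (`θ_T = n([T], ·)`
  on `reg|T|`, [Chirka1989, §16.1 p. 207: "locally constant on `reg A`"]) — so `T` has the shape of
  the lift of an effective analytic cycle of `X`, and the period functional `∫_{T/Λ}` of
  `ComplexTorusChainPeriods.lean` applies to it;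
* `ComplexTorus.tendsto_analyticCyclePeriod_limit` — **`∫_{Z_j} η → ∫_{T/Λ} η`** for every invariant
  form `η` [Fujiki1978, §2 Prop. 2.10]; `exists_int_torusPeriod_limit` — the periods of `T/Λ` on
  `H^{2p}(X, ℤ)` are integers [VoisinHodgeI2002, §11.1.2]; `eventually_analyticCycleClass_eq_limit` —
  **`[Z_j] = (∫_{T/Λ})^♭` for all large `j`**: the eventual class of the sequence is the class of the
  limit cycle, an integral Hodge class (`poincareDualForm_torusPeriod_limit_mem_integralHodgeClasses`);
* `ComplexTorus.tendsto_volume_limit` — **the volumes `vol(Z_j) = ∫_{Z_j} ω^p/p!` converge to the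
  degree `∫_{T/Λ} ω^p/p!` of the limit cycle** [Fujiki1978, §4 Prop. 4.1].

Theorems only; no new definitions, no named facts.

## References

* [Chirka1989] E. M. Chirka, *Complex Analytic Sets*, Kluwer 1989, §16.1 Prop. 1 and its proof
  (pp. 206–207), §15.1.
* [Fujiki1978] A. Fujiki, *Closedness of the Douady spaces of compact Kähler spaces*, Publ. RIMS 14
  (1978) 1–52, §2 Prop. 2.10, §4 Prop. 4.1.
* [VoisinHodgeI2002] C. Voisin, *Hodge Theory and Complex Algebraic Geometry I*, CUP 2002, §11.1.2
  Cor. 11.15, Thm. 11.21, §11.1.3 Prop. 11.20.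
* [Lange2023AbelianVarietiesComplex] H. Lange, *Abelian Varieties over the Complex Numbers*, Springer
  2023, §1.1.4, §6.2.1.
-/

noncomputable section

open scoped Manifold ENNReal NNReal Topology Distributions
open MeasureTheory TopologicalSpace Set Function Filter Metric Complex
open Literature.Geometry.GeometricMeasureTheory

namespace Literature.Geometry.Kaehler

-- Nested operator-norm instances on `Covector V m` / `Multivector V m`, as in `Currents.lean`.
set_option maxSynthPendingDepth 2

universe u

namespace ComplexTorus

/-! ## §1. `Λ`-invariance of the masses of `[π⁻¹Z]` and of the Lelong number of the limit -/

section Invariance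

variable {ι : Type*} [Fintype ι] {E : Type u} [NormedAddCommGroup E] [InnerProductSpace ℂ E]
  [FiniteDimensional ℂ E] [MeasurableSpace E] [BorelSpace E] (Φ : (ι → ℝ) ≃L[ℝ] E) {d : ℕ}

omit [Fintype ι] [FiniteDimensional ℂ E] in
/-- For a `Λ`-periodic `A ⊆ E`: `𝓗^s(A ∩ (λ + S)) = 𝓗^s(A ∩ S)` for every `S` and `λ ∈ Λ` (periodicity
of `A` and translation invariance of `𝓗^s`). [cite: Federer1969, 2.10.2; Lange2023AbelianVarietiesComplex, §1.1.1] -/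
theorem measure_inter_image_add_of_periodic {s : ℕ} {A : Set E}
    (hA : ∀ m : ι → ℤ, (fun y ↦ latticeVec Φ m + y) ⁻¹' A = A) (m : ι → ℤ) (S : Set E) :
    (μHE[s] : Measure E) (A ∩ (fun y ↦ latticeVec Φ m + y) '' S) = (μHE[s] : Measure E) (A ∩ S) := by
  have hinj : Injective fun y : E ↦ latticeVec Φ m + y := fun y y' h ↦ add_left_cancel h
  have himA : (fun y ↦ latticeVec Φ m + y) '' A = A := by
    conv_lhs => rw [← hA m]
    exact image_preimage_eq _ fun y ↦ ⟨y - latticeVec Φ m, add_sub_cancel _ _⟩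
  rw [← himA, ← image_inter hinj, himA]
  have h := euclideanHausdorffMeasure_image_add_smul (m := s) (latticeVec Φ m) one_pos (A ∩ S)
  simp only [one_smul, one_pow, ENNReal.ofReal_one, one_mul] at h
  exact h

/-- **The masses of `[π⁻¹Z]` in balls are `Λ`-invariant**: `‖[π⁻¹Z]‖(B(λ + a, r)) = ‖[π⁻¹Z]‖(B(a, r))`.
[cite: Chirka1989, §16.1, p. 206; Lange2023AbelianVarietiesComplex, §1.1.4] -/
theorem variation_analyticChain_ball_latticeVec_add {Z : Set (ComplexTorus Φ)}
    (hZ : HasPureDim 𝓘(ℂ, E) Z d) (m : ι → ℤ) (a : E) (r : ℝ) :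
    (analyticChain Φ hZ).toCurrent.variation (ball (latticeVec Φ m + a) r) =
      (analyticChain Φ hZ).toCurrent.variation (ball a r) := by
  have hball : ball (latticeVec Φ m + a) r = (fun y ↦ latticeVec Φ m + y) '' ball a r := by
    rw [show (fun y ↦ latticeVec Φ m + y) = (fun y ↦ latticeVec Φ m +ᵥ y) from rfl, Set.image_vadd,
      Metric.vadd_ball, vadd_eq_add]
  rw [analyticChain, HolomorphicChain.variation_toCurrent_ofSet_apply _ measurableSet_ball,
    HolomorphicChain.variation_toCurrent_ofSet_apply _ measurableSet_ball, image_val_liftSet, hball]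
  exact measure_inter_image_add_of_periodic Φ (const_add_preimage_cover_preimage Φ Z) m (ball a r)

variable {Z : ℕ → Set (ComplexTorus Φ)} (hZ : ∀ j, HasPureDim 𝓘(ℂ, E) (Z j) (d + 1))
  {T : HolomorphicChain 𝓘(ℂ, E) (⊤ : Opens E) (d + 1)}

/-- **The Lelong number of the limit chain is `Λ`-invariant**: if `[π⁻¹ Z_j] → [T]` in the sense of
currents then `n([T], λ + a) = n([T], a)` for all `a ∈ E`, `λ ∈ Λ` — both are the limit as `r → 0` of
`liminf_j ‖[π⁻¹Z_j]‖(B(·, r)) / c r^{2p}`, and these masses are `Λ`-invariant.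
[cite: Chirka1989, §16.1 Prop. 1 (proof), p. 207] -/
theorem finsum_lelongNumber_limit_latticeVec_add
    (hconv : ∀ ψ, Tendsto (fun j ↦ (analyticChain Φ (hZ j)).toCurrent ψ) atTop (𝓝 (T.toCurrent ψ)))
    (m : ι → ℤ) (a : E) :
    (∑ᶠ Y : Set (⊤ : Opens E), ENNReal.ofReal |(T.mult Y : ℝ)| *
        lelongNumber Y (d + 1) (latticeVec Φ m + a)) =
      ∑ᶠ Y : Set (⊤ : Opens E), ENNReal.ofReal |(T.mult Y : ℝ)| * lelongNumber Y (d + 1) a := by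
  have hpos : ∀ j Y, 0 ≤ (analyticChain Φ (hZ j)).mult Y := fun j Y ↦
    HolomorphicChain.mult_ofSet_nonneg (hasPureDim_liftSet Φ (hZ j)) Y
  have h1 := HolomorphicChain.tendsto_liminf_variation_ball_div_of_tendsto
    (fun j ↦ analyticChain Φ (hZ j)) hpos hconv (a := latticeVec Φ m + a) trivial
  have h2 := HolomorphicChain.tendsto_liminf_variation_ball_div_of_tendsto
    (fun j ↦ analyticChain Φ (hZ j)) hpos hconv (a := a) trivial
  simp only [variation_analyticChain_ball_latticeVec_add] at h1
  exact tendsto_nhds_unique h1 h2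

end Invariance

/-! ## §2. The carrier and the density of the limit chain are `Λ`-periodic -/

section Periodic

variable {ι : Type*} [Fintype ι] {E : Type u} [NormedAddCommGroup E] [InnerProductSpace ℂ E]
  [FiniteDimensional ℂ E] [MeasurableSpace E] [BorelSpace E] (Φ : (ι → ℝ) ≃L[ℝ] E) {d : ℕ}
  {Z : ℕ → Set (ComplexTorus Φ)} (hZ : ∀ j, HasPureDim 𝓘(ℂ, E) (Z j) (d + 1))
  {T : HolomorphicChain 𝓘(ℂ, E) (⊤ : Opens E) (d + 1)}

/-- The regular locus of `|T|` is `Λ`-periodic. [cite: Chirka1989, §2.3; §16.1 Prop. 1, p. 207] -/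
theorem translateTop_mem_regularLocus_support_limit_iff
    (hconv : ∀ ψ, Tendsto (fun j ↦ (analyticChain Φ (hZ j)).toCurrent ψ) atTop (𝓝 (T.toCurrent ψ)))
    (m : ι → ℤ) (y : (⊤ : Opens E)) :
    translateTop (latticeVec Φ m) y ∈ regularLocus 𝓘(ℂ, E) T.support ↔
      y ∈ regularLocus 𝓘(ℂ, E) T.support :=
  regularLocus_translateTop (translateTop_preimage_support_of_tendsto Φ hZ hconv m) y

/-- **The carrier `reg|T|` of the limit chain is `Λ`-periodic.** [cite: Chirka1989, §16.1 Prop. 1, p. 207] -/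
theorem latticeVec_add_mem_carrier_limit_iff
    (hconv : ∀ ψ, Tendsto (fun j ↦ (analyticChain Φ (hZ j)).toCurrent ψ) atTop (𝓝 (T.toCurrent ψ)))
    (m : ι → ℤ) (x : E) : latticeVec Φ m + x ∈ T.carrier ↔ x ∈ T.carrier := by
  rw [HolomorphicChain.carrier]
  constructor
  · rintro ⟨y, hy, hyx⟩
    refine ⟨⟨x, trivial⟩, ?_, rfl⟩
    have hy' : y = translateTop (latticeVec Φ m) ⟨x, trivial⟩ := Subtype.ext (by simp [hyx])
    rw [hy'] at hy
    exact (translateTop_mem_regularLocus_support_limit_iff Φ hZ hconv m _).1 hy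
  · rintro ⟨y, hy, hyx⟩
    refine ⟨translateTop (latticeVec Φ m) y, (translateTop_mem_regularLocus_support_limit_iff Φ hZ hconv m y).2 hy, ?_⟩
    rw [coe_translateTop, hyx]

/-- **The density `θ_T` of the limit chain is `Λ`-periodic on the carrier**: on `reg|T|`,
`θ_T = n([T], ·) ≥ 0` ([Chirka1989, §16.1, p. 207]: the multiplicity of the limit is read off the
Lelong number, "locally constant on `reg A`"), and `n([T], ·)` is `Λ`-invariant.
[cite: Chirka1989, §16.1 Prop. 1 (proof), p. 207] -/
theorem density_limit_latticeVec_add (hT : ∀ Y, 0 ≤ T.mult Y)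
    (hconv : ∀ ψ, Tendsto (fun j ↦ (analyticChain Φ (hZ j)).toCurrent ψ) atTop (𝓝 (T.toCurrent ψ)))
    (m : ι → ℤ) {x : E} (hx : x ∈ T.carrier) :
    T.density (latticeVec Φ m + x) = T.density x := by
  obtain ⟨y, hy, rfl⟩ := hx
  set y' : (⊤ : Opens E) := translateTop (latticeVec Φ m) y with hy'
  have hy'reg : y' ∈ regularLocus 𝓘(ℂ, E) T.support :=
    (translateTop_mem_regularLocus_support_limit_iff Φ hZ hconv m y).2 hy
  have hcoe : latticeVec Φ m + (y : E) = (y' : E) := by rw [hy', coe_translateTop]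
  rw [hcoe, HolomorphicChain.density_apply_coe, HolomorphicChain.density_apply_coe]
  -- both multiplicities are `≥ 0` with `ofReal |·| = n([T], ·)`, and the Lelong numbers agree
  have h1 := T.finsum_lelongNumber_eq_abs_multAt_of_mem_regularLocus hy'reg
  have h2 := T.finsum_lelongNumber_eq_abs_multAt_of_mem_regularLocus hy
  have heq : ENNReal.ofReal |(T.multAt y' : ℝ)| = ENNReal.ofReal |(T.multAt y : ℝ)| := by
    rw [← h1, ← h2, ← hcoe]
    exact finsum_lelongNumber_limit_latticeVec_add Φ hZ hconv m (y : E)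
  have h0' : (0 : ℝ) ≤ T.multAt y' := by exact_mod_cast T.multAt_nonneg hT y'
  have h0 : (0 : ℝ) ≤ T.multAt y := by exact_mod_cast T.multAt_nonneg hT y
  rw [abs_of_nonneg h0', abs_of_nonneg h0, ENNReal.ofReal_eq_ofReal_iff h0' h0] at heq
  exact_mod_cast heq

end Periodic

/-! ## §3. Periods, class and degree of the limit -/

section Periods

variable {ι : Type*} [Fintype ι] [DecidableEq ι] {E : Type u} [NormedAddCommGroup E]
  [InnerProductSpace ℂ E] [FiniteDimensional ℂ E] [MeasurableSpace E] [BorelSpace E]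
  (Φ : (ι → ℝ) ≃L[ℝ] E) {d : ℕ}
  {Z : ℕ → Set (ComplexTorus Φ)} (hZ : ∀ j, HasPureDim 𝓘(ℂ, E) (Z j) (d + 1))
  {T : HolomorphicChain 𝓘(ℂ, E) (⊤ : Opens E) (d + 1)}

omit [DecidableEq ι] [MeasurableSpace E] [BorelSpace E] in
/-- The carrier of `[π⁻¹ Z]` is `Λ`-periodic. [cite: Lange2023AbelianVarietiesComplex, §1.1.4] -/
private theorem carrier_analyticChain_periodic' {Z : Set (ComplexTorus Φ)}
    (hZ : HasPureDim 𝓘(ℂ, E) Z d) (m : ι → ℤ) (x : E) :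
    latticeVec Φ m + x ∈ (analyticChain Φ hZ).carrier ↔ x ∈ (analyticChain Φ hZ).carrier :=
  HolomorphicChain.carrier_ofSet_periodic Φ (hasPureDim_liftSet Φ hZ) (translateTop_preimage_liftSet Φ Z) m x

/-- **`∫_{Z_j} η → ∫_{T/Λ} η`**: the period functionals of the `Z_j` converge to the period functional
of the limit chain modulo `Λ`. [cite: Fujiki1978, §2 Prop. 2.10; Chirka1989, §16.1 Prop. 1, p. 207] -/
theorem tendsto_analyticCyclePeriod_limit (hT : ∀ Y, 0 ≤ T.mult Y)
    (hconv : ∀ ψ, Tendsto (fun j ↦ (analyticChain Φ (hZ j)).toCurrent ψ) atTop (𝓝 (T.toCurrent ψ)))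
    (η : E [⋀^Fin (2 * (d + 1))]→L[ℝ] ℂ) :
    Tendsto (fun j ↦ analyticCyclePeriod Φ (hZ j) η) atTop (𝓝 (T.torusPeriod Φ η)) :=
  HolomorphicChain.tendsto_torusPeriod_of_tendsto Φ (fun j ↦ analyticChain Φ (hZ j))
    (fun j ↦ carrier_analyticChain_periodic' Φ (hZ j))
    (fun j m _ hx ↦ density_analyticChain_latticeVec_add Φ (hZ j) m hx)
    (latticeVec_add_mem_carrier_limit_iff Φ hZ hconv)
    (fun m _ hx ↦ density_limit_latticeVec_add Φ hZ hT hconv m hx) hconv η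

/-- **The periods of the limit cycle on `H^{2p}(X, ℤ)` are integers.**
[cite: VoisinHodgeI2002, §11.1.2 Cor. 11.15 and Thm. 11.21] -/
theorem exists_int_torusPeriod_limit (hT : ∀ Y, 0 ≤ T.mult Y)
    (hconv : ∀ ψ, Tendsto (fun j ↦ (analyticChain Φ (hZ j)).toCurrent ψ) atTop (𝓝 (T.toCurrent ψ)))
    {η : E [⋀^Fin (2 * (d + 1))]→L[ℝ] ℂ} (hη : η ∈ integralForms Φ (2 * (d + 1))) :
    ∃ z : ℤ, T.torusPeriod Φ η = z :=
  T.exists_int_torusPeriod_eq_of_periodic Φ (latticeVec_add_mem_carrier_limit_iff Φ hZ hconv)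
    (fun m _ hx ↦ density_limit_latticeVec_add Φ hZ hT hconv m hx) hη

variable {n k : ℕ} (e : Fin n ≃ ι)

/-- **The eventual class of the sequence is the class of the limit cycle**: `[Z_j] = (∫_{T/Λ})^♭` in
`H^k(X, ℂ)` for all large `j` (the integral periods on the lattice monomials converge, hence are
eventually equal to those of `T/Λ`). [cite: Fujiki1978, §4 Prop. 4.1; VoisinHodgeI2002, §11.1.2 Cor. 11.15] -/
theorem eventually_analyticCycleClass_eq_limit (h : 2 * (d + 1) + k = n) (hT : ∀ Y, 0 ≤ T.mult Y)
    (hconv : ∀ ψ, Tendsto (fun j ↦ (analyticChain Φ (hZ j)).toCurrent ψ) atTop (𝓝 (T.toCurrent ψ))) :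
    ∀ᶠ j in atTop, analyticCycleClass Φ e h (hZ j) = poincareDualForm Φ e h (T.torusPeriod Φ) := by
  -- for each word, the integral periods converge, hence are eventually equal to the limit period
  have hw : ∀ w : Fin (2 * (d + 1)) → ι, ∀ᶠ j in atTop,
      analyticCyclePeriod Φ (hZ j) (latMonomial Φ (2 * (d + 1)) w) =
        T.torusPeriod Φ (latMonomial Φ (2 * (d + 1)) w) := by
    intro w
    obtain ⟨c, hc⟩ := eventually_analyticCyclePeriod_eq_of_tendsto_current Φ hZ hconv
      (latMonomial_mem_integralForms Φ _ w)
    have hlim := tendsto_analyticCyclePeriod_limit Φ hZ hT hconv (latMonomial Φ (2 * (d + 1)) w)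
    have hc' : c = T.torusPeriod Φ (latMonomial Φ (2 * (d + 1)) w) :=
      tendsto_nhds_unique (tendsto_const_nhds.congr' (hc.mono fun j hj ↦ hj.symm)) hlim
    exact hc.mono fun j hj ↦ hj.trans hc'
  filter_upwards [eventually_all.2 hw] with j hj
  refine eq_of_forall_poincarePairing_latMonomial_eq Φ e h fun w ↦ ?_
  rw [poincarePairing_analyticCycleClass, poincarePairing_poincareDualForm, hj w]

/-- **The class of the limit cycle is an integral Hodge class** (`2p + 2·codim = rk Λ`).
[cite: VoisinHodgeI2002, §11.1.3 Prop. 11.20] -/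
theorem poincareDualForm_torusPeriod_limit_mem_integralHodgeClasses {c : ℕ} (h : 2 * (d + 1) + 2 * c = n)
    (hT : ∀ Y, 0 ≤ T.mult Y)
    (hconv : ∀ ψ, Tendsto (fun j ↦ (analyticChain Φ (hZ j)).toCurrent ψ) atTop (𝓝 (T.toCurrent ψ))) :
    poincareDualForm Φ e h (T.torusPeriod Φ) ∈ integralHodgeClasses Φ c :=
  poincareDualForm_torusPeriod_mem_integralHodgeClasses Φ e h T
    fun _ hη ↦ exists_int_torusPeriod_limit Φ hZ hT hconv hη

/-- **The volumes converge to the degree of the limit cycle**: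
`vol(Z_j) = Re ∫_{Z_j} ω^p/p! → Re ∫_{T/Λ} ω^p/p!`. [cite: Fujiki1978, §4 Prop. 4.1; Chirka1989, §16.1 Prop. 1, p. 207] -/
theorem tendsto_volume_limit (hT : ∀ Y, 0 ≤ T.mult Y)
    (hconv : ∀ ψ, Tendsto (fun j ↦ (analyticChain Φ (hZ j)).toCurrent ψ) atTop (𝓝 (T.toCurrent ψ))) :
    Tendsto (fun j ↦ (μHE[2 * (d + 1)] : Measure E).real
        (periodBox Φ 0 ∩ (analyticChain Φ (hZ j)).carrier)) atTop
      (𝓝 (T.torusPeriod Φ (ofRealCLM.compContinuousAlternatingMap (kaehlerPow (d + 1)))).re) := by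
  have h := (continuous_re.tendsto _).comp
    (tendsto_analyticCyclePeriod_limit Φ hZ hT hconv (ofRealCLM.compContinuousAlternatingMap (kaehlerPow (d + 1))))
  refine h.congr fun j ↦ ?_
  simp only [Function.comp_apply]
  rw [analyticCyclePeriod_kaehlerPow, ofReal_re]

end Periods

end ComplexTorus

end Literature.Geometry.Kaehler

end
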